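import Summits.ResolutionOfSingularities.ResolutionOfSingularities.Theorems.UniversalCellsCampaignW82FrobeniusTwistGraded
import Summits.ResolutionOfSingularities.ResolutionOfSingularities.Theorems.UniversalCellsCampaignW82SmoothTwistGradedProofs
import Literature.AlgebraicGeometry.Resolution.ResolutionGlue
import Mathlib.FieldTheory.PurelyInseparable.Exponent
import Mathlib.FieldTheory.Perfect
import Mathlib.Algebra.CharP.Lemmas
import HarnessLib


/-!
# [OURS · L1 W8.2] The perfection step IS the Frobenius-twist step over ONE field (rung B, prime-field /
# family transfer) — proofs

Cell `res-hironaka` (run/shared/lean/pub/res-hironaka/), LADDER-RESOLUTION rung L (RESCUE), slot W8.2, host route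
`UniversalCells`, host item `PrimeFieldToPerfect` (stmt-ResolutionOfSingularities-15233), second door
`UniformComplexity` `PrimeModelTransfer` (stmt-ResolutionOfSingularities-8933). Prover res-L1-s82-pv-1 (gen 2).
THESES-FREE (imports only Theses-free campaign modules, Literature and Mathlib).

WHAT IS PROVED (names from the statement file Theorems/UniversalCellsCampaignW82FrobeniusTwistGraded.lean;
everything unconditional unless it carries `hCP : CossartPiltant2019`, FACT-LIST F-02):

* `exists_smoothModel_baseChange` — smooth proper birational models are stable under extension of the ground
  field (proper/smooth by base change, birational by FLAT base change `Theorems.isBirational_of_isPullback_of_flat`).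
* `hasSmoothFrobeniusTwistModel_of_hasSmoothModelAtFiniteLevel` — DOWN: a smooth model at a finite purely
  inseparable level `K'/K` is, pushed along the iterated Frobenius `K' → K` of exponent `e` (Mathlib
  `IsPurelyInseparable.iterateFrobenius`, `hasExponent_of_finiteDimensional`), a smooth model over `K` of the
  Frobenius twist `X₀ ×_{K,Frob^e} Spec K`.
* `hasResolution_pullback_of_hasSmoothFrobeniusTwistModel` — UP: a smooth model of a Frobenius twist yields a
  resolution of `X₀ ×_{K,ι} L` for EVERY perfect `L` and every `ι : K → L` (base change along
  `Frob_L^{-e} ∘ ι`, Mathlib `iterateFrobeniusEquiv`; smooth over a field ⇒ regular, Stacks 056S).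
* `frobeniusTwistStepAt_of_smoothTwistStepAt`, `perfectionStepAt_of_frobeniusTwistStepAt`,
  `perfectionStepAt_iff_frobeniusTwistStepAt`, `smoothTwistStepAt_iff_frobeniusTwistStepAt` — for EVERY field
  `M` of characteristic `p` and every grade `n` the three steps at `M` are equivalent. The new direction
  (`perfectionStepAt_of_frobeniusTwistStepAt`) descends `X / L` to a finite level `K₁ ⊆ L` (EGA IV₃ 8.8.2 (ii)),
  pushes it DOWN to `RatFunc M` along the iterated Frobenius `ψ : K₁ → RatFunc M` and re-embeds
  `RatFunc M ↪ L` by `φ = Frob_L^{-e} ∘ ι` (`φ ∘ ψ = (K₁ ⊆ L)`), so that `X ≅ (X₁ ×_{K₁,ψ} RatFunc M) ×_{φ} L`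
  with `L` purely inseparable over `φ(RatFunc M)`; then twists and pulls UP.
* the graded residual names in Frobenius-twist form, the rungs (curves unconditional, dimension `≤ 3` given
  F-02) and the kernel grades are in the sibling Theorems/UniversalCellsCampaignW82FrobeniusTwistRungs.lean.

CONSEQUENCE FOR THE SLOT (numbers, not adjectives): the residual of W8.2 — open exactly for grades `n ≥ 4` — now
has a kernel-checked normal form with hypothesis and conclusion over the SAME field `M(t)` and no quantifier
over levels: «resolution of integral separated schemes of finite type of dimension `≤ n` over `M(t)` ⇒ every
irreducible geometrically reduced `X₀` of dimension `≤ n` over `M(t)` has SOME FROBENIUS TWIST with a proper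
birational model SMOOTH over `M(t)`». At `n = 4`, `M` perfect (kernel grade `(5, 4)`): this is the precise
statement a rescue of the printed «transcendence degree d … dimension d + dim Z» device has to prove.

HONEST FRAMING. OURS work of the rescue rung; replaces the role of §17 ¶2 p.89 l.59–62 / §2 p.4 l.22–24 of
[Hironaka2017] as explained in the statement file; NOT a statement of the manuscript; nothing attributed to its
author; no typed candidate used even as a hypothesis; no external premise. AI work, weaker than expert review.

BARRIERS (`Literature/Barriers/ResolutionOfSingularities/`): `FrobeniusTwistResolution.lean`
(`not_hasResolution_Spec_frobTwist`) is respected through the hypothesis `IntegralOverPerfectClosure`;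
`RegularNotGeometricallyRegular.lean` is why the twist exponent is existentially quantified;
`InseparableBaseChangeResolution.lean` is not crossed (only SMOOTH models are transported).

## References
* A. Grothendieck, J. Dieudonné, EGA IV₃, Publ. Math. IHÉS 28 (1966), Thm. 8.8.2 (ii). [EGAIV3]
* U. Görtz, T. Wedhorn, *Algebraic Geometry I*, 2nd ed. (2020), Prop. 5.38, Thm. 10.63. [GortzWedhorn2020]
* The Stacks Project, Tag 056S. [StacksProject]
* Cruxes/PrimeFieldToPerfect/KERNEL.md §2 (E2); L/res-L1-s82-pv-1/NOTES.md — cell files.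
-/

noncomputable section

set_option linter.dupNamespace false -- mandated namespace of this single-conjunct summit

open _root_.CategoryTheory _root_.CategoryTheory.Limits _root_.AlgebraicGeometry
open Literature.AlgebraicGeometry.Resolution

namespace Summit.ResolutionOfSingularities.ResolutionOfSingularities.Theorems.CampaignW82

/-! ## Base change of a smooth model along a further map of ground fields -/

/-- **Smooth proper birational models are stable under extension of the ground field.** For
`f₀ : X₀ ⟶ Spec K` of finite type, ring maps of fields `σ : K → F`, `τ : F → F'`, and a proper birational
`ρ : Y ⟶ X₀ ×_{K,σ} Spec F` with `Y ⟶ Spec F` smooth, the base change of `ρ` along the flat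
`Spec F' ⟶ Spec F` is a proper birational `Y' ⟶ X₀ ×_{K,τσ} Spec F'` with `Y' ⟶ Spec F'` smooth (proper and
smooth by base change; birational by FLAT base change between Noetherian schemes,
`Theorems.isBirational_of_isPullback_of_flat`; transported along `(X₀ ×_K F) ×_F F' ≅ X₀ ×_K F'`).
[folklore] -/
theorem exists_smoothModel_baseChange {K F F' : Type} [Field K] [Field F] [Field F'] {X₀ : Scheme.{0}}
    (f₀ : X₀ ⟶ Spec (.of K)) [LocallyOfFiniteType f₀] [QuasiCompact f₀] (σ : K →+* F) (τ : F →+* F')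
    (θ : K →+* F') (hθ : τ.comp σ = θ)
    (Y : Scheme.{0}) (ρ : Y ⟶ pullback f₀ (Spec.map (CommRingCat.ofHom σ))) [IsProper ρ]
    (hbir : IsBirational ρ)
    [Smooth (ρ ≫ pullback.snd f₀ (Spec.map (CommRingCat.ofHom σ)))] :
    ∃ (Y' : Scheme.{0}) (ρ' : Y' ⟶ pullback f₀ (Spec.map (CommRingCat.ofHom θ))),
      IsProper ρ' ∧ IsBirational ρ' ∧
        Smooth (ρ' ≫ pullback.snd f₀ (Spec.map (CommRingCat.ofHom θ))) := by
  subst hθ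
  have e' : Spec.map (CommRingCat.ofHom τ) ≫ Spec.map (CommRingCat.ofHom σ) =
      Spec.map (CommRingCat.ofHom (τ.comp σ)) := by
    rw [← Spec.map_comp, ← CommRingCat.ofHom_comp]
  haveI : Flat (Spec.map (CommRingCat.ofHom τ)) := DeJong1996.Stage.flat_specMap τ
  haveI : IsNoetherian (pullback f₀ (Spec.map (CommRingCat.ofHom σ))) :=
    Scheme.isNoetherian_of_finiteType_over_field (pullback.snd f₀ (Spec.map (CommRingCat.ofHom σ)))
  haveI : IsNoetherian Y :=
    Scheme.isNoetherian_of_finiteType_over_field (ρ ≫ pullback.snd f₀ (Spec.map (CommRingCat.ofHom σ)))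
  -- the base change `π'` of `ρ` along `(X₀ ×_K F) ×_F F' → X₀ ×_K F`
  obtain ⟨π', h₁, h₂⟩ :
      ∃ π' : pullback (ρ ≫ pullback.snd f₀ (Spec.map (CommRingCat.ofHom σ)))
          (Spec.map (CommRingCat.ofHom τ)) ⟶
        pullback (pullback.snd f₀ (Spec.map (CommRingCat.ofHom σ))) (Spec.map (CommRingCat.ofHom τ)),
        pullback.fst (ρ ≫ pullback.snd f₀ (Spec.map (CommRingCat.ofHom σ)))
            (Spec.map (CommRingCat.ofHom τ)) ≫ ρ =
          π' ≫ pullback.fst (pullback.snd f₀ (Spec.map (CommRingCat.ofHom σ)))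
            (Spec.map (CommRingCat.ofHom τ)) ∧
        π' ≫ pullback.snd (pullback.snd f₀ (Spec.map (CommRingCat.ofHom σ)))
            (Spec.map (CommRingCat.ofHom τ)) =
          pullback.snd (ρ ≫ pullback.snd f₀ (Spec.map (CommRingCat.ofHom σ)))
            (Spec.map (CommRingCat.ofHom τ)) :=
    ⟨pullback.lift (pullback.fst _ _ ≫ ρ) (pullback.snd _ _)
      (by rw [Category.assoc, pullback.condition]),
      (pullback.lift_fst _ _ _).symm, pullback.lift_snd _ _ _⟩
  have big := IsPullback.of_hasPullback (ρ ≫ pullback.snd f₀ (Spec.map (CommRingCat.ofHom σ)))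
    (Spec.map (CommRingCat.ofHom τ))
  rw [← h₂] at big
  have sq : IsPullback
      (pullback.fst (ρ ≫ pullback.snd f₀ (Spec.map (CommRingCat.ofHom σ)))
        (Spec.map (CommRingCat.ofHom τ))) π' ρ
      (pullback.fst (pullback.snd f₀ (Spec.map (CommRingCat.ofHom σ))) (Spec.map (CommRingCat.ofHom τ))) :=
    IsPullback.of_bot big h₁ (IsPullback.of_hasPullback _ _)
  haveI : IsProper π' := MorphismProperty.of_isPullback sq ‹IsProper ρ›
  have hbir' : IsBirational π' :=
    Summit.ResolutionOfSingularities.ResolutionOfSingularities.Theorems.isBirational_of_isPullback_of_flat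
      sq hbir
  have hsm' : Smooth (π' ≫ pullback.snd (pullback.snd f₀ (Spec.map (CommRingCat.ofHom σ)))
      (Spec.map (CommRingCat.ofHom τ))) := by
    rw [h₂]
    infer_instance
  -- transport along `ε : (X₀ ×_K F) ×_F F' ≅ X₀ ×_K F'`
  let ε : pullback (pullback.snd f₀ (Spec.map (CommRingCat.ofHom σ))) (Spec.map (CommRingCat.ofHom τ)) ≅
      pullback f₀ (Spec.map (CommRingCat.ofHom (τ.comp σ))) :=
    pullbackLeftPullbackSndIso f₀ (Spec.map (CommRingCat.ofHom σ)) (Spec.map (CommRingCat.ofHom τ)) ≪≫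
      pullback.congrHom rfl e'
  have hε : ε.hom ≫ pullback.snd f₀ (Spec.map (CommRingCat.ofHom (τ.comp σ))) =
      pullback.snd (pullback.snd f₀ (Spec.map (CommRingCat.ofHom σ))) (Spec.map (CommRingCat.ofHom τ)) := by
    simp only [ε, Iso.trans_hom, Category.assoc, pullback.congrHom_hom, pullback.lift_snd,
      Category.comp_id]
    exact pullbackLeftPullbackSndIso_hom_snd _ _ _
  refine ⟨_, π' ≫ ε.hom, inferInstance, hbir'.comp_iso ε.hom, ?_⟩
  rw [Category.assoc, hε]
  exact hsm'

/-! ## Down: a smooth model at a finite level is a smooth model of a Frobenius twist -/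

/-- **A smooth model at a finite purely inseparable level `K'` pushes down to a smooth model of a Frobenius
twist over `K`.** A finite purely inseparable `K'/K` has an exponent `e` (Mathlib
`IsPurelyInseparable.hasExponent_of_finiteDimensional`), and `x ↦ x^{p^e}` is a ring map `ψ : K' → K` with
`ψ ∘ (K → K') = Frob^e` (`IsPurelyInseparable.iterateFrobenius`); base change along `Spec ψ : Spec K ⟶ Spec K'`
(`exists_smoothModel_baseChange`) turns a proper birational model of `X₀ ×_K K'` smooth over `K'` into one of
`X₀ ×_{K,Frob^e} K` smooth over `K`. [folklore] -/
theorem hasSmoothFrobeniusTwistModel_of_hasSmoothModelAtFiniteLevel (p : ℕ) [Fact p.Prime] (K : Type)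
    [Field K] [CharP K p] {X₀ : Scheme.{0}} (f₀ : X₀ ⟶ Spec (.of K)) [LocallyOfFiniteType f₀]
    [QuasiCompact f₀] (h : HasSmoothModelAtFiniteLevel K f₀) : HasSmoothFrobeniusTwistModel p K f₀ := by
  obtain ⟨K', _, _, _, _, Y, ρ, hprop, hbir, hsm⟩ := h
  haveI := hprop
  haveI := hsm
  -- the exponent of `K'/K` and the iterated Frobenius `ψ : K' → K`
  haveI : IsPurelyInseparable.HasExponent K K' := inferInstance
  let e : ℕ := IsPurelyInseparable.exponent K K'
  let ψ : K' →+* K := IsPurelyInseparable.iterateFrobenius K K' p le_rfl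
  have hψ : ψ.comp (algebraMap K K') = iterateFrobenius K p e := by
    ext x
    change ψ (algebraMap K K' x) = iterateFrobenius K p e x
    rw [iterateFrobenius_def]
    exact IsPurelyInseparable.iterateFrobenius_algebraMap K' p le_rfl x
  obtain ⟨Y', ρ', h₁, h₂, h₃⟩ :=
    exists_smoothModel_baseChange f₀ (algebraMap K K') ψ (iterateFrobenius K p e) hψ Y ρ hbir
  exact ⟨e, Y', ρ', h₁, h₂, h₃⟩

/-! ## Up: a smooth model of a Frobenius twist gives a resolution over every perfect extension -/

/-- **A smooth model of a Frobenius twist base-changes to a resolution over every PERFECT extension `L` of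
`K`.** With `ι : K → L` and `L` perfect, `χ := Frob_L^{-e} ∘ ι : K → L` satisfies `χ ∘ Frob_K^e = ι`, so
`X₀ ×_{K,ι} L = (X₀ ×_{K,Frob^e} K) ×_{K,χ} L`; base change of the smooth model along the flat `Spec χ` is proper
and birational with source smooth over the field `L`, hence regular (Stacks 056S). [folklore] -/
theorem hasResolution_pullback_of_hasSmoothFrobeniusTwistModel (p : ℕ) [Fact p.Prime] (K : Type) [Field K]
    [CharP K p] {X₀ : Scheme.{0}} (f₀ : X₀ ⟶ Spec (.of K)) [LocallyOfFiniteType f₀] [QuasiCompact f₀]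
    (h : HasSmoothFrobeniusTwistModel p K f₀) (L : Type) [Field L] [PerfectField L] (ι : K →+* L) :
    Scheme.HasResolution (pullback f₀ (Spec.map (CommRingCat.ofHom ι))) := by
  obtain ⟨e, Y, π, hprop, hbir, hsm⟩ := h
  haveI := hprop
  haveI := hsm
  haveI : CharP L p := charP_of_injective_ringHom ι.injective p
  -- `χ = Frob_L^{-e} ∘ ι`, with `χ ∘ Frob_K^e = ι`
  let χ : K →+* L := (iterateFrobeniusEquiv L p e).symm.toRingHom.comp ι
  have hχ : χ.comp (iterateFrobenius K p e) = ι := by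
    ext x
    change (iterateFrobeniusEquiv L p e).symm (ι (iterateFrobenius K p e x)) = ι x
    rw [iterateFrobenius_def, map_pow, ← iterateFrobeniusEquiv_def, RingEquiv.symm_apply_apply]
  obtain ⟨Y', ρ', h₁, h₂, h₃⟩ :=
    exists_smoothModel_baseChange f₀ (iterateFrobenius K p e) χ ι hχ Y π hbir
  haveI := h₁
  haveI := h₃
  haveI : IsNoetherian Y' :=
    Scheme.isNoetherian_of_finiteType_over_field (ρ' ≫ pullback.snd f₀ (Spec.map (CommRingCat.ofHom ι)))
  -- smooth over the field `L`, hence regular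
  have hreg : Scheme.IsRegular Y' := fun y =>
    isRegularLocalRing_stalk_of_smooth_of_field (ρ' ≫ pullback.snd f₀ (Spec.map (CommRingCat.ofHom ι))) y
  exact ⟨Y', ρ', h₁, h₂, hreg⟩

/-! ## The Frobenius-twist step is equivalent to the smooth-twist step and to the perfection step -/

/-- **The smooth-twist step implies the Frobenius-twist step** (take the level `K = RatFunc M` itself and
push the smooth model down along the iterated Frobenius). [folklore] -/
theorem frobeniusTwistStepAt_of_smoothTwistStepAt (p : ℕ) [Fact p.Prime] (M : Type) [Field M] [CharP M p]
    {n : WithBot ℕ∞} (h : SmoothTwistStepAt M n) : FrobeniusTwistStepAt p M n := by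
  intro hM X₀ f₀ hs hl hq hd hint
  haveI := hl
  haveI := hq
  exact hasSmoothFrobeniusTwistModel_of_hasSmoothModelAtFiniteLevel p (RatFunc M) f₀
    (h hM (RatFunc M) X₀ f₀ hs hl hq hd hint)

/-- **The Frobenius-twist step implies the perfection step** (every `M` of characteristic `p`, every grade).
Given a perfect purely inseparable `L ⊇ RatFunc M =: K` (structure map `ι`) and an integral separated
`f : X ⟶ Spec L` of finite type and dimension `≤ n`: descend `X ≅ X₁ ×_{K₁} L` to a finite level `K₁ ⊆ L`
(EGA IV₃ 8.8.2 (ii), `Limits.exists_isPullback_specMap_subalgebra`); push `X₁` down to `K` along the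
iterated Frobenius `ψ : K₁ → K` of the finite purely inseparable `K₁/K` (exponent `e`):
`X₁' := X₁ ×_{K₁,ψ} K`, so that `X ≅ X₁' ×_{K,φ} L` for `φ := Frob_L^{-e} ∘ ι` (`φ ∘ ψ = (K₁ ⊆ L)`); `X₁'` is
separated of finite type over `K`, of dimension `dim X ≤ n`, and integral over the perfect closure (witness
`(L, φ)`: `L` is purely inseparable over `φ(K) ⊇ ι(K)`); the Frobenius-twist step gives a smooth model of a
Frobenius twist of `X₁'` over `K`, which `hasResolution_pullback_of_hasSmoothFrobeniusTwistModel` (with the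
embedding `φ`) turns into a resolution of `X₁' ×_{K,φ} L ≅ X`. [cite: EGAIV3, Thm. 8.8.2 (ii)] -/
theorem perfectionStepAt_of_frobeniusTwistStepAt (p : ℕ) [Fact p.Prime] (M : Type) [Field M] [CharP M p]
    {n : WithBot ℕ∞} (h : FrobeniusTwistStepAt p M n) : PerfectionStepAt M n := by
  intro hM L _ _ _ _ X f hs hl hq hX hd
  classical
  haveI := hs
  haveI := hl
  haveI := hq
  haveI : CharP L p := charP_of_injective_algebraMap (algebraMap (RatFunc M) L).injective p
  -- ### Step 1: descent of `X / L` to a finitely generated `RatFunc M`-subalgebra `R ⊆ L`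
  obtain ⟨R, X', p', π, hRfg, hsep', hlft', hqc', hsq⟩ :=
    Literature.AlgebraicGeometry.Limits.exists_isPullback_specMap_subalgebra (K := RatFunc M) f
  haveI := hsep'
  haveI := hlft'
  haveI := hqc'
  obtain ⟨t, ht⟩ := hRfg
  obtain ⟨K₁, hK₁⟩ : ∃ K₁ : IntermediateField (RatFunc M) L,
      K₁ = IntermediateField.adjoin (RatFunc M) (↑t : Set L) := ⟨_, rfl⟩
  have hRK₁ : ∀ x : L, x ∈ R → x ∈ K₁ := fun x hx => by
    rw [hK₁]
    rw [← ht] at hx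
    exact IntermediateField.algebra_adjoin_le_adjoin (RatFunc M) _ hx
  haveI : Module.Finite (RatFunc M) K₁ := by
    rw [hK₁]
    exact IntermediateField.finiteDimensional_adjoin fun x _ =>
      IsPurelyInseparable.isIntegral' (RatFunc M) x
  let ι₀ : R →+* K₁ := R.val.toRingHom.codRestrict K₁ fun x => hRK₁ x.1 x.2
  have hι₀ : (algebraMap K₁ L).comp ι₀ = R.val.toRingHom := RingHom.ext fun _ => rfl
  have hfac : Spec.map (CommRingCat.ofHom (algebraMap K₁ L)) ≫ Spec.map (CommRingCat.ofHom ι₀) =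
      Spec.map (CommRingCat.ofHom R.val.toRingHom) := by
    rw [← Spec.map_comp, ← CommRingCat.ofHom_comp, hι₀]
  -- ### Step 2: the model `X₁ = X' ×_R Spec K₁` over `K₁` and `T : X ≅ X₁ ×_{K₁} Spec L`
  let f₁ : pullback p' (Spec.map (CommRingCat.ofHom ι₀)) ⟶ Spec (.of K₁) := pullback.snd _ _
  have hw : π ≫ p' = (f ≫ Spec.map (CommRingCat.ofHom (algebraMap K₁ L))) ≫
      Spec.map (CommRingCat.ofHom ι₀) := by
    rw [Category.assoc, hfac]; exact hsq.w
  let c : X ⟶ pullback p' (Spec.map (CommRingCat.ofHom ι₀)) :=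
    pullback.lift π (f ≫ Spec.map (CommRingCat.ofHom (algebraMap K₁ L))) hw
  have hc₁ : c ≫ pullback.fst _ _ = π := pullback.lift_fst _ _ _
  have hc₂ : c ≫ f₁ = f ≫ Spec.map (CommRingCat.ofHom (algebraMap K₁ L)) := pullback.lift_snd _ _ _
  have hbig : IsPullback (c ≫ pullback.fst _ _) f p'
      (Spec.map (CommRingCat.ofHom (algebraMap K₁ L)) ≫ Spec.map (CommRingCat.ofHom ι₀)) := by
    rw [hc₁, hfac]; exact hsq
  have T : IsPullback c f f₁ (Spec.map (CommRingCat.ofHom (algebraMap K₁ L))) :=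
    hbig.of_right hc₂ (IsPullback.of_hasPullback p' (Spec.map (CommRingCat.ofHom ι₀)))
  -- ### Step 3: push `X₁` down to `K = RatFunc M` along the iterated Frobenius `ψ : K₁ → K`
  haveI : IsPurelyInseparable.HasExponent (RatFunc M) K₁ := inferInstance
  let e : ℕ := IsPurelyInseparable.exponent (RatFunc M) K₁
  let ψ : K₁ →+* RatFunc M := IsPurelyInseparable.iterateFrobenius (RatFunc M) K₁ p le_rfl
  -- `φ = Frob_L^{-e} ∘ ι : K → L`, with `φ ∘ ψ = (K₁ ⊆ L)`
  let φ : RatFunc M →+* L := (iterateFrobeniusEquiv L p e).symm.toRingHom.comp (algebraMap (RatFunc M) L)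
  have hφψ : φ.comp ψ = algebraMap K₁ L := by
    ext y
    change (iterateFrobeniusEquiv L p e).symm (algebraMap (RatFunc M) L (ψ y)) = algebraMap K₁ L y
    rw [IsScalarTower.algebraMap_apply (RatFunc M) K₁ L,
      IsPurelyInseparable.algebraMap_iterateFrobenius (RatFunc M) p le_rfl y, map_pow,
      ← iterateFrobeniusEquiv_def, RingEquiv.symm_apply_apply]
  have hφfac : Spec.map (CommRingCat.ofHom φ) ≫ Spec.map (CommRingCat.ofHom ψ) =
      Spec.map (CommRingCat.ofHom (algebraMap K₁ L)) := by
    rw [← Spec.map_comp, ← CommRingCat.ofHom_comp, hφψ]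
  -- `X₁' := X₁ ×_{K₁,ψ} Spec K` with structure map `f₁'`, and `X ≅ X₁' ×_{K,φ} Spec L`
  let f₁' : pullback f₁ (Spec.map (CommRingCat.ofHom ψ)) ⟶ Spec (.of (RatFunc M)) := pullback.snd _ _
  let ε : pullback f₁' (Spec.map (CommRingCat.ofHom φ)) ≅
      pullback f₁ (Spec.map (CommRingCat.ofHom (algebraMap K₁ L))) :=
    pullbackLeftPullbackSndIso f₁ (Spec.map (CommRingCat.ofHom ψ)) (Spec.map (CommRingCat.ofHom φ)) ≪≫
      pullback.congrHom rfl hφfac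
  -- `X₁'` is of finite type over `K`, of dimension `≤ n`, and integral over the perfect closure
  have hint₁ : IsIntegral (pullback f₁ (Spec.map (CommRingCat.ofHom (algebraMap K₁ L)))) := by
    haveI : Nonempty ↥(pullback f₁ (Spec.map (CommRingCat.ofHom (algebraMap K₁ L)))) :=
      ⟨T.isoPullback.hom.base (Nonempty.some inferInstance)⟩
    exact isIntegral_of_isOpenImmersion T.isoPullback.inv
  have hint' : IsIntegral (pullback f₁' (Spec.map (CommRingCat.ofHom φ))) := by
    haveI := hint₁
    haveI : Nonempty ↥(pullback f₁' (Spec.map (CommRingCat.ofHom φ))) :=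
      ⟨ε.inv.base (Nonempty.some inferInstance)⟩
    exact isIntegral_of_isOpenImmersion ε.hom
  have hdim' : topologicalKrullDim ↥(pullback f₁ (Spec.map (CommRingCat.ofHom ψ))) ≤ n := by
    -- `dim X₁' = dim (X₁' ×_{K,φ} L) = dim X`
    rw [← Literature.AlgebraicGeometry.Motives.topologicalKrullDim_eq_of_isPullback φ f₁'
      (pullback.fst f₁' (Spec.map (CommRingCat.ofHom φ))) (pullback.snd _ _)
      (IsPullback.of_hasPullback f₁' (Spec.map (CommRingCat.ofHom φ)))]
    have e₁ : topologicalKrullDim ↥(pullback f₁' (Spec.map (CommRingCat.ofHom φ))) =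
        topologicalKrullDim ↥(pullback f₁ (Spec.map (CommRingCat.ofHom (algebraMap K₁ L)))) :=
      IsHomeomorph.topologicalKrullDim_eq _ (Scheme.homeoOfIso ε).isHomeomorph
    have e₂ : topologicalKrullDim ↥X =
        topologicalKrullDim ↥(pullback f₁ (Spec.map (CommRingCat.ofHom (algebraMap K₁ L)))) :=
      IsHomeomorph.topologicalKrullDim_eq _ (Scheme.homeoOfIso T.isoPullback).isHomeomorph
    rw [e₁, ← e₂]
    exact hd
  -- the witness `(L, φ)`: `L` is purely inseparable over `φ(K)`
  have hPI : @IsPurelyInseparable (RatFunc M) L _ _ φ.toAlgebra := by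
    letI : Algebra (RatFunc M) L := φ.toAlgebra
    rw [isPurelyInseparable_iff_pow_mem (RatFunc M) p]
    intro z
    obtain ⟨m, y, hy⟩ := (isPurelyInseparable_iff_pow_mem K₁ p).1
      (inferInstance : IsPurelyInseparable K₁ L) z
    refine ⟨m, ψ y, ?_⟩
    rw [← hy]
    exact RingHom.congr_fun hφψ y
  have hIOPC : IntegralOverPerfectClosure (RatFunc M) f₁' :=
    ⟨L, inferInstance, inferInstance, φ.toAlgebra, hPI, hint'⟩
  -- ### Step 4: the smooth model of a Frobenius twist of `X₁'`, pulled up to `L` along `φ`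
  have hmodel : HasSmoothFrobeniusTwistModel p (RatFunc M) f₁' :=
    h hM _ f₁' inferInstance inferInstance inferInstance hdim' hIOPC
  have hres : Scheme.HasResolution (pullback f₁' (Spec.map (CommRingCat.ofHom φ))) :=
    hasResolution_pullback_of_hasSmoothFrobeniusTwistModel p (RatFunc M) f₁' hmodel L φ
  exact (hres.of_iso ε.hom).of_iso T.isoPullback.inv

/-- **THE RESIDUAL OF SLOT W8.2 OVER ONE FIELD**: for every field `M` of characteristic `p` and every grade
`n`, `PerfectionStepAt M n ↔ FrobeniusTwistStepAt p M n` — resolution over the perfect `M(t)^{perf}` (given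
resolution over `M(t)`, dimension `≤ n`) holds iff for every irreducible geometrically reduced `X₀` of
dimension `≤ n` over `M(t)` SOME FROBENIUS TWIST `X₀ ×_{M(t),Frob^e} M(t)` has a proper birational model SMOOTH
over `M(t)` (form (E2) of Cruxes/PrimeFieldToPerfect/KERNEL.md §2). [folklore] -/
theorem perfectionStepAt_iff_frobeniusTwistStepAt (p : ℕ) [Fact p.Prime] (M : Type) [Field M] [CharP M p]
    (n : WithBot ℕ∞) : PerfectionStepAt M n ↔ FrobeniusTwistStepAt p M n :=
  ⟨fun h => frobeniusTwistStepAt_of_smoothTwistStepAt p M (smoothTwistStepAt_of_perfectionStepAt M h),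
    perfectionStepAt_of_frobeniusTwistStepAt p M⟩

/-- The smooth-twist step and the Frobenius-twist step are equivalent (through the perfection step).
[folklore] -/
theorem smoothTwistStepAt_iff_frobeniusTwistStepAt (p : ℕ) [Fact p.Prime] (M : Type) [Field M]
    [CharP M p] (n : WithBot ℕ∞) : SmoothTwistStepAt M n ↔ FrobeniusTwistStepAt p M n :=
  (perfectionStepAt_iff_smoothTwistStepAt M n).symm.trans (perfectionStepAt_iff_frobeniusTwistStepAt p M n)

end Summit.ResolutionOfSingularities.ResolutionOfSingularities.Theorems.CampaignW82

end
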